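import Summits.Ventures.DiscreteObjects.Hadamard.ResignOddOrder

/-!
# Hadamard 668 census, family F12 — two signed automorphisms with commuting permutation parts commute as signed
# permutations (odd exponent) (kernel tool)

Framing: lottery ticket; floor = certified bounds/negative ranges.

Cell pub-namedobj (venture DiscreteObjects), target (H), hadamard gen 16.  Let `S = (σ, σ', d, e)` and `T = (τ, τ', d', e')`
be signed-permutation automorphisms of a matrix `H` with no zero entry (e.g. Hadamard) such that `στ = τσ` and `σ'τ' = τ'σ'`.
The commutator of the signed permutation matrices `P_S, P_T` is then a DIAGONAL signed automorphism, hence `± 1`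
(`signedAut_comm_sign`: `d(τ x) d'(x) = ε d'(σ x) d(x)` and `e(τ' y) e'(y) = ε e'(σ' y) e(y)` with one `ε = ±1`).  If moreover
`τ^p = τ'^p = 1` for an ODD `p`, then `P_T^p = c·1` is central and conjugating by `P_S` gives `ε^p = 1`, so `ε = 1`
(`signedAut_comm_of_odd`): **the sign functions commute exactly**, `d(τ x) d'(x) = d'(σ x) d(x)`.  Used in
`ElemAbelianRank2_23` (after re-signing one generator to a pure permutation automorphism, the other generator's row
signs are constant along its cycles).  Ours, not literature; no `sorry`.
-/

namespace Summit.Ventures.DiscreteObjects.Hadamard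

open Finset BigOperators

variable {ι : Type*}

/-- from `A x * B y = C x * D y` for `±1`-valued functions: `A x * C x = B y * D y` -/
private lemma pm_swap {A B C D : ℤ} (hB : B = 1 ∨ B = -1) (hC : C = 1 ∨ C = -1)
    (h : A * B = C * D) : A * C = B * D := by
  have hBB : B * B = 1 := pm_mul_self hB
  have hCC : C * C = 1 := pm_mul_self hC
  calc A * C = A * C * (B * B) := by rw [hBB, mul_one]
    _ = (A * B) * C * B := by ring
    _ = (C * D) * C * B := by rw [h]
    _ = (C * C) * (B * D) := by ring
    _ = B * D := by rw [hCC, one_mul]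

/-- **commutator sign.**  Two signed automorphisms of a matrix without zero entries whose permutation parts commute:
their sign functions commute up to ONE global sign `ε`. -/
theorem signedAut_comm_sign {H : Matrix ι ι ℤ} (hH0 : ∀ i j, H i j ≠ 0) [Nonempty ι]
    {σ σ' τ τ' : Equiv.Perm ι} {d e d' e' : ι → ℤ}
    (hS : IsSignedAut H σ σ' d e) (hT : IsSignedAut H τ τ' d' e')
    (hc : Commute σ τ) (hc' : Commute σ' τ') :
    ∃ ε : ℤ, (ε = 1 ∨ ε = -1) ∧ (∀ x, d (τ x) * d' x = ε * (d' (σ x) * d x)) ∧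
      (∀ y, e (τ' y) * e' y = ε * (e' (σ' y) * e y)) := by
  obtain ⟨hd, he, hA⟩ := hS
  obtain ⟨hd', he', hB⟩ := hT
  -- the basic identity: d(τx) e(τ'y) d'(x) e'(y) = d'(σx) e'(σ'y) d(x) e(y)
  have key : ∀ x y, (d (τ x) * d' x) * (e (τ' y) * e' y) = (d' (σ x) * d x) * (e' (σ' y) * e y) := by
    intro x y
    have h1 : H ((σ * τ) x) ((σ' * τ') y) = d (τ x) * e (τ' y) * (d' x * e' y * H x y) := by
      rw [Equiv.Perm.mul_apply, Equiv.Perm.mul_apply, hA, hB]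
    have h2 : H ((τ * σ) x) ((τ' * σ') y) = d' (σ x) * e' (σ' y) * (d x * e y * H x y) := by
      rw [Equiv.Perm.mul_apply, Equiv.Perm.mul_apply, hB, hA]
    rw [hc.eq, hc'.eq] at h1
    rw [h1] at h2
    have hne := hH0 x y
    have : ((d (τ x) * d' x) * (e (τ' y) * e' y) - (d' (σ x) * d x) * (e' (σ' y) * e y)) * H x y = 0 := by
      linarith
    rcases mul_eq_zero.mp this with h0 | h0
    · linarith
    · exact absurd h0 hne
  obtain ⟨x₀⟩ := ‹Nonempty ι›
  -- ε := the common value of (d(τx) d'(x)) (d'(σx) d(x))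
  refine ⟨(d (τ x₀) * d' x₀) * (d' (σ x₀) * d x₀), ?_, fun x => ?_, fun y => ?_⟩
  · have h1 : d (τ x₀) * d' x₀ = 1 ∨ d (τ x₀) * d' x₀ = -1 := by
      rcases hd (τ x₀) with h | h <;> rcases hd' x₀ with h' | h' <;> simp [h, h']
    have h2 : d' (σ x₀) * d x₀ = 1 ∨ d' (σ x₀) * d x₀ = -1 := by
      rcases hd' (σ x₀) with h | h <;> rcases hd x₀ with h' | h' <;> simp [h, h']
    rcases h1 with h | h <;> rcases h2 with h' | h' <;> simp [h, h']
  · -- d(τx) d'(x) · [d'(σx) d(x)] is independent of x (compare x with x₀ at the column y = σ' x₀)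
    have hy := key x (σ' x₀)
    have hy0 := key x₀ (σ' x₀)
    have hBpm : e (τ' (σ' x₀)) * e' (σ' x₀) = 1 ∨ e (τ' (σ' x₀)) * e' (σ' x₀) = -1 := by
      rcases he (τ' (σ' x₀)) with h | h <;> rcases he' (σ' x₀) with h' | h' <;> simp [h, h']
    have hCpm : d' (σ x) * d x = 1 ∨ d' (σ x) * d x = -1 := by
      rcases hd' (σ x) with h | h <;> rcases hd x with h' | h' <;> simp [h, h']
    have hC0pm : d' (σ x₀) * d x₀ = 1 ∨ d' (σ x₀) * d x₀ = -1 := by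
      rcases hd' (σ x₀) with h | h <;> rcases hd x₀ with h' | h' <;> simp [h, h']
    have e1 := pm_swap hBpm hCpm hy
    have e2 := pm_swap hBpm hC0pm hy0
    have hCC : (d' (σ x) * d x) * (d' (σ x) * d x) = 1 := pm_mul_self hCpm
    calc d (τ x) * d' x = d (τ x) * d' x * ((d' (σ x) * d x) * (d' (σ x) * d x)) := by rw [hCC, mul_one]
      _ = ((d (τ x) * d' x) * (d' (σ x) * d x)) * (d' (σ x) * d x) := by ring
      _ = ((d (τ x₀) * d' x₀) * (d' (σ x₀) * d x₀)) * (d' (σ x) * d x) := by rw [e1, ← e2]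
  · have hy0 := key x₀ y
    -- A B = C D with A = d(τx₀)d'(x₀), B = e(τ'y)e'(y), C = d'(σx₀)d(x₀), D = e'(σ'y)e(y):
    -- B = (A C) D since A A = 1
    have hAA : (d (τ x₀) * d' x₀) * (d (τ x₀) * d' x₀) = 1 := pm_mul_self (by
      rcases hd (τ x₀) with h | h <;> rcases hd' x₀ with h' | h' <;> simp [h, h'])
    calc e (τ' y) * e' y = ((d (τ x₀) * d' x₀) * (d (τ x₀) * d' x₀)) * (e (τ' y) * e' y) := by rw [hAA, one_mul]
      _ = (d (τ x₀) * d' x₀) * ((d (τ x₀) * d' x₀) * (e (τ' y) * e' y)) := by ring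
      _ = (d (τ x₀) * d' x₀) * ((d' (σ x₀) * d x₀) * (e' (σ' y) * e y)) := by rw [hy0]
      _ = (d (τ x₀) * d' x₀) * (d' (σ x₀) * d x₀) * (e' (σ' y) * e y) := by ring

/-- iterating the commutation: `d(τ^k x) · cyc τ d' x k = ε^k · cyc τ d' (σ x) k · d(x)` -/
lemma signedAut_comm_pow {σ τ : Equiv.Perm ι} {d d' : ι → ℤ} (hc : Commute σ τ)
    {ε : ℤ} (hcomm : ∀ x, d (τ x) * d' x = ε * (d' (σ x) * d x)) (x : ι) (k : ℕ) :
    d ((τ ^ k) x) * cyc τ d' x k = ε ^ k * (cyc τ d' (σ x) k * d x) := by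
  induction k generalizing x with
  | zero => simp [cyc]
  | succ k ih =>
    rw [pow_succ τ k, Equiv.Perm.mul_apply, cyc_succ τ d' x k, cyc_succ τ d' (σ x) k, pow_succ ε k]
    have h := ih (τ x)
    -- σ (τ x) = τ (σ x)
    have hστ : σ (τ x) = τ (σ x) := by
      have := congrArg (fun π => π x) hc.eq
      simpa [Equiv.Perm.mul_apply] using this
    rw [hστ] at h
    calc d ((τ ^ k) (τ x)) * (d' x * cyc τ d' (τ x) k)
        = d' x * (d ((τ ^ k) (τ x)) * cyc τ d' (τ x) k) := by ring
      _ = d' x * (ε ^ k * (cyc τ d' (τ (σ x)) k * d (τ x))) := by rw [h]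
      _ = ε ^ k * cyc τ d' (τ (σ x)) k * (d (τ x) * d' x) := by ring
      _ = ε ^ k * cyc τ d' (τ (σ x)) k * (ε * (d' (σ x) * d x)) := by rw [hcomm x]
      _ = ε ^ k * ε * (d' (σ x) * cyc τ d' (τ (σ x)) k * d x) := by ring

/-- **exact commutation of signs for odd exponent.**  If moreover `τ^p = τ'^p = 1` with `p` odd (and `H` has no zero
entry), the global sign is `ε = 1`: `d(τ x) d'(x) = d'(σ x) d(x)` and `e(τ' y) e'(y) = e'(σ' y) e(y)`. -/
theorem signedAut_comm_of_odd {H : Matrix ι ι ℤ} (hH0 : ∀ i j, H i j ≠ 0) [Nonempty ι]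
    {σ σ' τ τ' : Equiv.Perm ι} {d e d' e' : ι → ℤ}
    (hS : IsSignedAut H σ σ' d e) (hT : IsSignedAut H τ τ' d' e')
    (hc : Commute σ τ) (hc' : Commute σ' τ') {p : ℕ} (hodd : Odd p) (hτ : τ ^ p = 1) (hτ' : τ' ^ p = 1) :
    (∀ x, d (τ x) * d' x = d' (σ x) * d x) ∧ (∀ y, e (τ' y) * e' y = e' (σ' y) * e y) := by
  obtain ⟨ε, hε, hrow, hcol⟩ := signedAut_comm_sign hH0 hS hT hc hc'
  -- cycle products of T over p steps: D'(x) E'(y) = 1, hence D' constant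
  have hDE : ∀ x y, cyc τ d' x p * cyc τ' e' y p = 1 := by
    intro x y
    have h := signedAut_pow hT p x y
    rw [hτ, hτ', Equiv.Perm.one_apply, Equiv.Perm.one_apply] at h
    have hne := hH0 x y
    have : (cyc τ d' x p * cyc τ' e' y p - 1) * H x y = 0 := by linarith
    rcases mul_eq_zero.mp this with h0 | h0
    · linarith
    · exact absurd h0 hne
  obtain ⟨x₀⟩ := ‹Nonempty ι›
  have hDconst : ∀ x, cyc τ d' x p = cyc τ d' x₀ p := by
    intro x
    have h1 := hDE x x₀
    have h2 := hDE x₀ x₀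
    have hE : cyc τ' e' x₀ p = 1 ∨ cyc τ' e' x₀ p = -1 := cyc_pm τ' e' hT.2.1 x₀ p
    have hEE := pm_mul_self hE
    calc cyc τ d' x p = cyc τ d' x p * (cyc τ' e' x₀ p * cyc τ' e' x₀ p) := by rw [hEE, mul_one]
      _ = (cyc τ d' x p * cyc τ' e' x₀ p) * cyc τ' e' x₀ p := by ring
      _ = (cyc τ d' x₀ p * cyc τ' e' x₀ p) * cyc τ' e' x₀ p := by rw [h1, h2]
      _ = cyc τ d' x₀ p * (cyc τ' e' x₀ p * cyc τ' e' x₀ p) := by ring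
      _ = cyc τ d' x₀ p := by rw [hEE, mul_one]
  -- iterate p times at x₀: d(τ^p x₀) D'(x₀) = ε^p D'(σ x₀) d(x₀), i.e. d x₀ D = ε^p D d x₀ ⇒ ε^p = 1
  have hit := signedAut_comm_pow hc hrow x₀ p
  rw [hτ, Equiv.Perm.one_apply, hDconst (σ x₀)] at hit
  have hD : cyc τ d' x₀ p = 1 ∨ cyc τ d' x₀ p = -1 := cyc_pm τ d' hT.1 x₀ p
  have hdx : d x₀ = 1 ∨ d x₀ = -1 := hS.1 x₀
  have hεp : ε ^ p = 1 := by
    have hne : d x₀ * cyc τ d' x₀ p ≠ 0 := mul_ne_zero (pm_ne_zero hdx) (pm_ne_zero hD)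
    have : (ε ^ p - 1) * (d x₀ * cyc τ d' x₀ p) = 0 := by linarith
    rcases mul_eq_zero.mp this with h0 | h0
    · linarith
    · exact absurd h0 hne
  have hε1 : ε = 1 := by
    rcases hε with h | h
    · exact h
    · rw [h, Odd.neg_one_pow hodd] at hεp; norm_num at hεp
  subst hε1
  exact ⟨fun x => by simpa using hrow x, fun y => by simpa using hcol y⟩

end Summit.Ventures.DiscreteObjects.Hadamard
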